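import Literature.NumberTheory.GaloisCohomology.CyclicClassLocalArtinSymbolZpExtension
import Literature.NumberTheory.GaloisCohomology.KummerMapPadic
import HarnessLib

/-!
# The cup product `H¹(G_K, ℤ_p(1)) × Hom_cont(G_K, ℤ_p) → H²(G_K, ℤ_p(1))` and Kato II Lemma 1.4.5 in `ℤ_p`-coefficients:
# `inv_∞(κ_∞(u) ∪ ψ) = -ψ(σ_u)`

Topic `NumberTheory/GaloisCohomology`; namespace `Literature.NumberTheory.GaloisCohomology`. Sequel of
`LocalInvariantMapPadic.lean` (`ℤ_p(1)(K̄) = tateModuleMuPadic K p`, THE `p`-adic invariant map `invPadic`),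
`KummerMapPadic.lean` (the `p`-adic Kummer class `kummerPadic K p x`) and `CyclicClassLocalArtinSymbolZpExtension.lean`
(Kato II Lemma 1.4.5 LEVELWISE at a completion `K_v`, `v ∣ p`). Definitions with bodies and theorems; no named fact, no
instance, no `sorry`.

Kato's reciprocity law (LNM 1553, Ch. II §1.4) lives in `H²(K, ℤ_p(1)) ≅ ℤ_p`; its calibration (1.4.2, Lemma 1.4.5:
`inv((exp a) ∪ log χ_cyclo) = -Tr_{K/ℚ_p}(a)`, "well known in local class field theory") pairs a Kummer class in
`H¹(K, ℤ_p(1))` with a CHARACTER `ψ ∈ H¹(K, ℤ_p) = Hom_cont(G_K, ℤ_p)` through `ℤ_p(1) × ℤ_p → ℤ_p(1)`. This file supplies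
that pairing as a cup-product datum of the tree and packages the tree's levelwise Lemma 1.4.5 into ONE `ℤ_p`-valued identity:

* `padicTrivRep K p` — `ℤ_p` with the trivial action of `G_K`; `homOneCocycle` — a continuous additive `ψ : G_K → ℤ_p` as a
  `1`-cocycle (`H¹(G, A) = Hom(G, A)` for trivial `A`);
* `twistPairingPadic K p : ℤ_p(1) × ℤ_p → ℤ_p(1)`, `(ζ, a) ↦ ζ^a` — coordinates `(a mod p^k) · ζ_k` (the tree's scalar
  endomorphisms `Prop121vii.scalarEnd`), coherence `red_twistCoord_succ`, equivariance, continuity — as a `ContPairing`;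
* `scalarEndPadicMor K p k : ℤ_p ⟶ μ_{p^k}^∨(1) = Hom(μ_{p^k}, μ_{p^k})`, `a ↦ (a mod p^k) · id`, a morphism of topological
  representations, and ★ `cohomologyMap_projHom_cupProduct_twistPairingPadic`: **`H²(ℤ_p(1) ↠ μ_{p^k})(x ∪ [ψ]) =
  H¹(↠)(x) ∪_{ev} H¹(a ↦ (a mod p^k)·id)[ψ]`** — the level-`p^k` image of the `p`-adic cup product is the evaluation cup
  product `μ_{p^k} × μ_{p^k}^∨(1) → μ_{p^k}` of local Tate duality (naturality `ContPairing.cupProduct_map`), the currency of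
  the tree's local symbol formulae (`CyclicClassLocalArtinSymbol*`);
* ★★ `invPadic_cupProduct_kummerPadic_eq_neg_of_isCyclotomic` — **Kato II Lemma 1.4.5 at `v ∣ p` in `ℤ_p`-coefficients**:
  for the cyclotomic `ℤ_p`-extension `κ : Γ_K ↠ ℤ_p` of a number field `K`, `v ∣ p`, a unit `u ∈ 𝒪_vˣ` and `σ ∈ Γ_K` with
  `ε_p(σ) = N_{K_v/ℚ_p}(u)`: `inv_∞(κ_∞(u) ∪ [κ ∘ res_v]) = -κ(σ)` in `ℤ_p` (a `p`-adic integer is determined by its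
  residues: `toZModPow_invPadic`, `cohomologyMap_projHom_kummerPadic`, the level formula, and the tree's
  `invLevel_cupProduct_δ₀_eq_neg_toZModPow_of_isCyclotomic` at every `m`).

This is floor (d) of the K3 programme of the line `kato_lever` on crux K★ stmt-BirchSwinnertonDyer-22226 in final
(`ℤ_p`-packaged) form; BSD / K★ / [REC] are NOT proved by any of this.

## References
* K. Kato, *Lectures on the approach to Iwasawa theory for Hasse–Weil L-functions via B_dR, I*, LNM 1553 (1993),
  Ch. II 1.4.2, Lemma 1.4.5. [Kato1993LNM1553]
* J.-P. Serre, *Local Fields*, GTM 67 (1979), Ch. XIV §1 Prop. 3. [SerreLocalFields1979]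
* J. Neukirch, A. Schmidt, K. Wingberg, *Cohomology of Number Fields*, 2nd ed. (2008), I §4 (1.4.2), II §7 (2.7.5),
  VII (7.2.6). [NeukirchSchmidtWingberg2008]
-/

noncomputable section

open CategoryTheory Function NumberField IsDedekindDomain Field ValuativeRel
open scoped NumberField

namespace Literature.NumberTheory.GaloisCohomology

open _root_.TopRep _root_.ContRepresentation _root_.ContinuousCohomology
open Literature.NumberTheory.GaloisRepresentations
open Literature.NumberTheory.GaloisRepresentations.DiscreteGaloisModule
open Literature.NumberTheory.GaloisRepresentations.IsNonarchimedeanLocalField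
open Literature.NumberTheory.EllipticCurves
open Literature.AnabelianGeometry.AbsoluteAnabelian
open Literature.AnabelianGeometry.AbsoluteAnabelian.Prop121vii

attribute [local instance] absoluteGaloisGroup_compactSpace

/-! ### `ℤ_p` with trivial action; characters as `1`-cocycles -/

section Trivial

variable (K : Type) [Field K] (p : ℕ) [hp : Fact p.Prime]

/-- **`ℤ_p` with the trivial action of `G_K`**, as a jointly continuous representation (the coefficients of
`H¹(K, ℤ_p) = Hom_cont(G_K, ℤ_p)`, the home of `log χ_cyclo`, Kato II 1.2.2). [cite: Kato1993LNM1553, Ch. II 1.2.2 and 1.4.2] -/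
abbrev padicTrivRep : ContinuousRep (absoluteGaloisGroup K) ℤ ℤ_[p] := ContinuousRep.trivial _ _ _

/-- **A continuous additive map `ψ : G_K → ℤ_p` as a continuous crossed homomorphism** with values in the trivial
representation `ℤ_p` (`H¹(G, A) = Hom_cont(G, A)` for trivial `A`). [cite: SerreGaloisCohomology1997, I §2.3] -/
def homOneCocycle (ψ : C(absoluteGaloisGroup K, ℤ_[p])) (hψ : ∀ σ τ, ψ (σ * τ) = ψ σ + ψ τ) :
    contOneCocycles (padicTrivRep K p).toTopRep :=
  ⟨ψ, fun σ τ => by rw [hψ]; rfl⟩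

/-- Unfolding `homOneCocycle`. [cite: SerreGaloisCohomology1997, I §2.3] -/
@[simp] theorem homOneCocycle_apply (ψ : C(absoluteGaloisGroup K, ℤ_[p])) (hψ : ∀ σ τ, ψ (σ * τ) = ψ σ + ψ τ)
    (σ : absoluteGaloisGroup K) : (homOneCocycle K p ψ hψ).1 σ = ψ σ := rfl

end Trivial

/-! ### Torsion bookkeeping on `μ_{p^k}` -/

section Torsion

variable (K : Type) [Field K] (p : ℕ) [hp : Fact p.Prime]

/-- `p^k ≠ 0`: instance bookkeeping for the levels. [folklore] -/
private theorem neZero_pow₅ (k : ℕ) : NeZero (p ^ k) := ⟨pow_ne_zero k hp.out.ne_zero⟩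

attribute [local instance] neZero_pow₅

/-- `μ_n(K̄)` is killed by `n` (integer multiples). [folklore] -/
private theorem natCast_zsmul_muCarrier {n : ℕ} (v : MuCarrier K n) : (n : ℤ) • v = 0 := by
  rw [natCast_zsmul]
  exact muVal_injective K n (by rw [muVal_nsmul, muVal_pow_eq_one, muVal_zero])

/-- On an `n`-torsion element an integer multiple only depends on the multiplier modulo `n`. [folklore] -/
private theorem natMod_zsmul_eq {M : Type*} [AddCommGroup M] {n : ℕ} (m : ℕ) (x : M) (hx : (n : ℤ) • x = 0) :
    ((m % n : ℕ) : ℤ) • x = (m : ℤ) • x := by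
  conv_rhs => rw [← Nat.mod_add_div m n, Nat.cast_add, add_zsmul, Nat.cast_mul, mul_comm, mul_zsmul, hx, zsmul_zero,
    add_zero]

/-- `ℤ_p → ℤ/p^k` is continuous for the discrete topology on `ℤ/p^k` (its fibres are open balls). [folklore] -/
private theorem continuous_toZModPow' (k : ℕ) : Continuous (PadicInt.toZModPow k : ℤ_[p] → ZMod (p ^ k)) := by
  refine ((IsLocallyConstant.iff_isOpen_fiber).mpr fun c => ?_).continuous
  rw [isOpen_iff_mem_nhds]
  intro x hx
  have hx' : PadicInt.toZModPow k x = c := hx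
  have hpos : (0 : ℝ) < (p : ℝ) ^ (-(k : ℤ)) := zpow_pos (by exact_mod_cast hp.out.pos) _
  refine Filter.mem_of_superset (Metric.ball_mem_nhds x hpos) fun y hy => ?_
  change PadicInt.toZModPow k y ∈ ({c} : Set (ZMod (p ^ k)))
  rw [Set.mem_singleton_iff, ← hx', ← sub_eq_zero, ← map_sub, ← RingHom.mem_ker, PadicInt.ker_toZModPow,
    ← PadicInt.norm_le_pow_iff_mem_span_pow, ← dist_eq_norm]
  exact (Metric.mem_ball.mp hy).le

/-- Additivity of `a ↦ a.val • x` on an `n`-torsion element `x`. [folklore] -/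
private theorem val_add_zsmul' {M : Type*} [AddCommGroup M] {n : ℕ} [NeZero n] (a b : ZMod n) (x : M)
    (hx : (n : ℤ) • x = 0) : (((a + b).val : ℤ)) • x = ((a.val : ℤ)) • x + ((b.val : ℤ)) • x := by
  rw [← add_zsmul, ← Nat.cast_add, ZMod.val_add, natMod_zsmul_eq _ x hx]

/-- The reductions `a mod p^{k+1}` and `a mod p^k` of `a ∈ ℤ_p` act identically on `μ_{p^k}`. [folklore] -/
private theorem val_toZModPow_succ_zsmul (k : ℕ) (a : ℤ_[p]) (x : MuCarrier K (p ^ k)) :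
    (((PadicInt.toZModPow (k + 1) a).val : ℤ)) • x = (((PadicInt.toZModPow k a).val : ℤ)) • x := by
  have h : PadicInt.toZModPow k a =
      ZMod.castHom (pow_dvd_pow p k.le_succ) (ZMod (p ^ k)) (PadicInt.toZModPow (k + 1) a) :=
    (RingHom.congr_fun (PadicInt.zmod_cast_comp_toZModPow k (k + 1) k.le_succ) a).symm
  rw [h, ZMod.castHom_apply, ZMod.cast_eq_val, ZMod.val_natCast]
  exact (natMod_zsmul_eq _ x (natCast_zsmul_muCarrier K x)).symm

end Torsion

/-! ### The twist pairing `ℤ_p(1) × ℤ_p → ℤ_p(1)`, `(ζ, a) ↦ ζ^a` -/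

section Twist

variable (K : Type) [Field K] (p : ℕ) [hp : Fact p.Prime]

attribute [local instance] neZero_pow₅

/-- **Level-`k` coordinate of `ζ^a`**: `(a mod p^k) · ζ_k ∈ μ_{p^k}(K̄)` (an integer multiple, well defined since `μ_{p^k}`
is `p^k`-torsion; it is the tree's scalar endomorphism `scalarEnd K (a mod p^k) ∈ μ_{p^k}^∨(1)` evaluated at `ζ_k`,
`twistCoord_eq_scalarEnd`). [cite: Kato1993LNM1553, Ch. II 1.4.2] -/
def twistCoord (k : ℕ) (ζ : (muPadicSystem K p).limit) (a : ℤ_[p]) : MuCarrier K (p ^ k) :=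
  (((PadicInt.toZModPow k a).val : ℤ)) • (ζ : ∀ k, MuCarrier K (p ^ k)) k

/-- Unfolding `twistCoord`. [cite: Kato1993LNM1553, Ch. II 1.4.2] -/
theorem twistCoord_eq_zsmul (k : ℕ) (ζ : (muPadicSystem K p).limit) (a : ℤ_[p]) :
    twistCoord K p k ζ a = (((PadicInt.toZModPow k a).val : ℤ)) • (ζ : ∀ k, MuCarrier K (p ^ k)) k := rfl

/-- `twistCoord` through the tree's scalar endomorphisms of `μ_{p^k}`: `(a mod p^k)·id` evaluated at `ζ_k`.
[cite: SerreLocalFields1979, XIV §1] -/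
theorem twistCoord_eq_scalarEnd (k : ℕ) (ζ : (muPadicSystem K p).limit) (a : ℤ_[p]) :
    twistCoord K p k ζ a = scalarEnd K (PadicInt.toZModPow k a) ((ζ : ∀ k, MuCarrier K (p ^ k)) k) := rfl

/-- ★ **Coherence**: the `p`-th power map `μ_{p^{k+1}} → μ_{p^k}` sends the level-`(k+1)` coordinate to the level-`k` one.
[cite: NeukirchSchmidtWingberg2008, II §7 (2.7.5)] -/
theorem red_twistCoord_succ (k : ℕ) (ζ : (muPadicSystem K p).limit) (a : ℤ_[p]) :
    (muPadicSystem K p).red (n := k) (m := k + 1) (Nat.le_succ k) (twistCoord K p (k + 1) ζ a) =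
      twistCoord K p k ζ a := by
  rw [twistCoord_eq_zsmul, twistCoord_eq_zsmul, map_zsmul, (muPadicSystem K p).red_apply_coe ζ,
    val_toZModPow_succ_zsmul]

/-- The family of coordinates lies in `ℤ_p(1)(K̄) = lim_k μ_{p^k}(K̄)`. [cite: NeukirchSchmidtWingberg2008, II §7 (2.7.5)] -/
theorem twistCoord_mem_limit (ζ : (muPadicSystem K p).limit) (a : ℤ_[p]) :
    (fun k => twistCoord K p k ζ a) ∈ (muPadicSystem K p).limit := fun _ _ h =>
  (muPadicSystem K p).chain_compat (muPadicChain K p) (fun h => (muPadicSystem K p).red h)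
    (muPadicSystem K p).red_refl (fun h₁ h₂ x => (muPadicSystem K p).red_trans h₁ h₂ x)
    (fun k => twistCoord K p k ζ a) (fun k => red_twistCoord_succ K p k ζ a) h

/-- **`ζ^a ∈ ℤ_p(1)(K̄)`** for `ζ ∈ ℤ_p(1)(K̄)`, `a ∈ ℤ_p`. [cite: Kato1993LNM1553, Ch. II 1.4.2] -/
def twistVal (ζ : (muPadicSystem K p).limit) (a : ℤ_[p]) : (muPadicSystem K p).limit :=
  ⟨fun k => twistCoord K p k ζ a, twistCoord_mem_limit K p ζ a⟩

/-- Coordinates of `ζ^a`. [cite: Kato1993LNM1553, Ch. II 1.4.2] -/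
@[simp] theorem coe_twistVal (ζ : (muPadicSystem K p).limit) (a : ℤ_[p]) (k : ℕ) :
    ((twistVal K p ζ a : (muPadicSystem K p).limit) : ∀ k, MuCarrier K (p ^ k)) k = twistCoord K p k ζ a := rfl

/-- Additivity of the coordinates in `ζ`. [cite: Kato1993LNM1553, Ch. II 1.4.2] -/
theorem twistCoord_add_left (k : ℕ) (ζ ζ' : (muPadicSystem K p).limit) (a : ℤ_[p]) :
    twistCoord K p k (ζ + ζ') a = twistCoord K p k ζ a + twistCoord K p k ζ' a := by
  rw [twistCoord_eq_zsmul, twistCoord_eq_zsmul, twistCoord_eq_zsmul, AddSubgroup.coe_add, Pi.add_apply, zsmul_add]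

/-- Additivity of the coordinates in `a` (`μ_{p^k}` is `p^k`-torsion). [cite: Kato1993LNM1553, Ch. II 1.4.2] -/
theorem twistCoord_add_right (k : ℕ) (ζ : (muPadicSystem K p).limit) (a b : ℤ_[p]) :
    twistCoord K p k ζ (a + b) = twistCoord K p k ζ a + twistCoord K p k ζ b := by
  rw [twistCoord_eq_zsmul, twistCoord_eq_zsmul, twistCoord_eq_zsmul, map_add]
  exact val_add_zsmul' _ _ _ (natCast_zsmul_muCarrier K _)

/-- **`(ζ, a) ↦ ζ^a` as a biadditive map `ℤ_p(1) →+ ℤ_p →+ ℤ_p(1)`.** [cite: Kato1993LNM1553, Ch. II 1.4.2] -/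
def twistHom : (muPadicSystem K p).limit →+ ℤ_[p] →+ (muPadicSystem K p).limit :=
  AddMonoidHom.mk'
    (fun ζ => AddMonoidHom.mk' (fun a => twistVal K p ζ a) fun a b =>
      Subtype.ext (funext fun k => by
        simp only [coe_twistVal, AddSubgroup.coe_add, Pi.add_apply, twistCoord_add_right]))
    fun ζ ζ' => AddMonoidHom.ext fun a => Subtype.ext (funext fun k => by
      simp only [AddMonoidHom.mk'_apply, AddMonoidHom.add_apply, coe_twistVal, AddSubgroup.coe_add, Pi.add_apply,
        twistCoord_add_left])

/-- Coordinates of `twistHom`. [cite: Kato1993LNM1553, Ch. II 1.4.2] -/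
@[simp] theorem coe_twistHom (ζ : (muPadicSystem K p).limit) (a : ℤ_[p]) (k : ℕ) :
    ((twistHom K p ζ a : (muPadicSystem K p).limit) : ∀ k, MuCarrier K (p ^ k)) k = twistCoord K p k ζ a := rfl

/-- Equivariance of the coordinates: `(σ ζ)^a = σ (ζ^a)` at every level (the Galois action on `μ_{p^k}` is by group
automorphisms). [cite: Kato1993LNM1553, Ch. II 1.4.2] -/
theorem twistCoord_smul (k : ℕ) (σ : absoluteGaloisGroup K) (ζ : (muPadicSystem K p).limit) (a : ℤ_[p]) :
    twistCoord K p k (tateModuleMuPadic K p σ ζ) a = mu K (p ^ k) σ (twistCoord K p k ζ a) := by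
  rw [twistCoord_eq_zsmul, twistCoord_eq_zsmul, map_zsmul]
  rfl

/-- ★ **`ζ ↦ ζ^a` is `G_K`-equivariant** (trivial action on `a`). [cite: Kato1993LNM1553, Ch. II 1.4.2] -/
theorem twistHom_smul (σ : absoluteGaloisGroup K) (ζ : (muPadicSystem K p).limit) (a : ℤ_[p]) :
    twistHom K p (tateModuleMuPadic K p σ ζ) (padicTrivRep K p σ a) = tateModuleMuPadic K p σ (twistHom K p ζ a) :=
  Subtype.ext (funext fun k => by
    rw [coe_twistHom, ContinuousRep.trivial_apply, twistCoord_smul]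
    rfl)

/-- The coordinate maps `(ζ, a) ↦ (a mod p^k) · ζ_k` are continuous (they factor through the discrete
`μ_{p^k} × ℤ/p^k`). [cite: NeukirchSchmidtWingberg2008, II §7 (2.7.5)] -/
theorem continuous_twistCoord (k : ℕ) :
    Continuous fun q : (muPadicSystem K p).limit × ℤ_[p] => twistCoord K p k q.1 q.2 := by
  have h1 : Continuous fun q : (muPadicSystem K p).limit × ℤ_[p] =>
      (((q.1 : ∀ k, MuCarrier K (p ^ k)) k), PadicInt.toZModPow k q.2) :=
    (((muPadicSystem K p).continuous_projAddHom k).comp continuous_fst).prodMk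
      ((continuous_toZModPow' p k).comp continuous_snd)
  have h2 : Continuous fun r : MuCarrier K (p ^ k) × ZMod (p ^ k) => (((r.2.val : ℤ)) • r.1 : MuCarrier K (p ^ k)) :=
    continuous_of_discreteTopology
  exact (h2.comp h1).congr fun _ => rfl

/-- `(ζ, a) ↦ ζ^a` is jointly continuous. [cite: NeukirchSchmidtWingberg2008, II §7 (2.7.5)] -/
theorem continuous_twistHom : Continuous fun q : (muPadicSystem K p).limit × ℤ_[p] => twistHom K p q.1 q.2 := by
  refine continuous_induced_rng.2 (continuous_pi fun k => ?_)
  exact continuous_twistCoord K p k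

/-- ★ **The twist pairing `ℤ_p(1) × ℤ_p → ℤ_p(1)`, `(ζ, a) ↦ ζ^a`, as a continuous `G_K`-equivariant pairing** of the
topological representations `tateModuleMuPadic K p` and `padicTrivRep K p` — the cup-product datum of Kato's
`H¹(K, ℤ_p(1)) × H¹(K, ℤ_p) → H²(K, ℤ_p(1))` (II 1.4.2, Lemma 1.4.5). [cite: Kato1993LNM1553, Ch. II 1.4.2 and Lemma 1.4.5] -/
def twistPairingPadic :
    ContPairing (tateModuleMuPadic K p).toTopRep (padicTrivRep K p).toTopRep (tateModuleMuPadic K p).toTopRep where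
  toLin := LinearMap.mk₂ ℤ (fun ζ a => twistHom K p ζ a) (fun ζ ζ' a => by rw [map_add, AddMonoidHom.add_apply])
    (fun c ζ a => by
      change (twistHom K p).flip a (c • ζ) = c • (twistHom K p).flip a ζ
      rw [map_zsmul])
    (fun ζ a b => map_add _ _ _) (fun c ζ a => map_zsmul _ _ _)
  continuous_toLin := continuous_twistHom K p
  toLin_smul σ ζ a := twistHom_smul K p σ ζ a

/-- Unfolding `twistPairingPadic`. [cite: Kato1993LNM1553, Ch. II 1.4.2] -/
@[simp] theorem twistPairingPadic_toLin_apply (ζ : (muPadicSystem K p).limit) (a : ℤ_[p]) :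
    (twistPairingPadic K p).toLin ζ a = twistHom K p ζ a := rfl

/-! ### The level morphisms `ℤ_p → μ_{p^k}^∨(1)` and the cup-product compatibility -/

/-- `a ↦ (a mod p^k) · id ∈ Hom(μ_{p^k}, μ_{p^k})`, additive. [cite: SerreLocalFields1979, XIV §1] -/
def scalarEndPadic (k : ℕ) : ℤ_[p] →+ TateDual K (MuCarrier K (p ^ k)) (p ^ k) where
  toFun a := scalarEnd K (PadicInt.toZModPow k a)
  map_zero' := by rw [map_zero, scalarEnd_zero]
  map_add' a b := by rw [map_add, scalarEnd_add]

/-- Unfolding `scalarEndPadic`. [cite: SerreLocalFields1979, XIV §1] -/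
@[simp] theorem scalarEndPadic_apply (k : ℕ) (a : ℤ_[p]) :
    scalarEndPadic K p k a = scalarEnd K (PadicInt.toZModPow k a) := rfl

/-- **`ℤ_p ⟶ μ_{p^k}^∨(1)`, `a ↦ (a mod p^k) · id`, as a morphism of topological `G_K`-representations** (continuous:
locally constant; equivariant: `G_K` acts trivially on scalar endomorphisms, `tateDual_scalarEnd`).
[cite: SerreLocalFields1979, XIV §1] -/
def scalarEndPadicMor (k : ℕ) : (padicTrivRep K p).toTopRep ⟶ ((mu K (p ^ k)).tateDual (p ^ k)).toTopRep :=
  TopRep.ofHom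
    { toFun := scalarEndPadic K p k
      map_add' := map_add _
      map_smul' := fun c a => map_zsmul _ c a
      cont := (continuous_of_discreteTopology (f := fun t : ZMod (p ^ k) => scalarEnd K t)).comp
        (continuous_toZModPow' p k)
      isIntertwining' := fun σ => ContinuousLinearMap.ext fun a => by
        change scalarEndPadic K p k (padicTrivRep K p σ a) = (mu K (p ^ k)).tateDual (p ^ k) σ (scalarEndPadic K p k a)
        rw [ContinuousRep.trivial_apply, scalarEndPadic_apply, tateDual_scalarEnd] }

/-- Unfolding `scalarEndPadicMor`. [cite: SerreLocalFields1979, XIV §1] -/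
@[simp] theorem scalarEndPadicMor_hom_apply (k : ℕ) (a : ℤ_[p]) :
    (scalarEndPadicMor K p k).hom a = scalarEnd K (PadicInt.toZModPow k a) := rfl

/-- The image of a character-cocycle under `a ↦ (a mod p^k)·id` is the scalar cocycle `τ ↦ (ψ τ mod p^k) · id`, valued as
`x ↦ (ψ τ mod p^k).val • x`. [cite: SerreLocalFields1979, XIV §1] -/
theorem pullback_scalarEndPadicMor_apply (k : ℕ) (ψ : C(absoluteGaloisGroup K, ℤ_[p]))
    (hψ : ∀ σ τ, ψ (σ * τ) = ψ σ + ψ τ) (τ : absoluteGaloisGroup K) (x : MuCarrier K (p ^ k)) :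
    (contOneCocycles.pullback (ContinuousMonoidHom.id _) (resIdHom (scalarEndPadicMor K p k))
        (homOneCocycle K p ψ hψ)).1 τ x = (((PadicInt.toZModPow k (ψ τ)).val : ℤ)) • x := rfl

variable [LocallyCompactSpace (absoluteGaloisGroup K)]

/-- ★ **`H²(ℤ_p(1) ↠ μ_{p^k})(x ∪ y) = H¹(ℤ_p(1) ↠ μ_{p^k})(x) ∪_{ev} H¹(a ↦ (a mod p^k)·id)(y)`**: at every level the
`p`-adic twist cup product is the evaluation cup product `μ_{p^k} × μ_{p^k}^∨(1) → μ_{p^k}` of local Tate duality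
(`tateDualPairing`) of the projected classes (covariant naturality `ContPairing.cupProduct_map`; the coordinate of `ζ^a` IS
`(a mod p^k)·ζ_k`). [cite: NeukirchSchmidtWingberg2008, I §4 (1.4.2)] [cite: Kato1993LNM1553, Ch. II 1.4.2] -/
theorem cohomologyMap_projHom_cupProduct_twistPairingPadic (k : ℕ)
    (x : continuousCohomology 1 (tateModuleMuPadic K p).toTopRep)
    (y : continuousCohomology 1 (padicTrivRep K p).toTopRep) :
    cohomologyMap ((muPadicSystem K p).projHom k) 2 ((twistPairingPadic K p).cupProduct x y) =
      ((mu K (p ^ k)).tateDualPairing (p ^ k)).cupProduct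
        (cohomologyMap ((muPadicSystem K p).projHom k) 1 x) (cohomologyMap (scalarEndPadicMor K p k) 1 y) :=
  ContPairing.cupProduct_map _ _ ((muPadicSystem K p).projHom k) (scalarEndPadicMor K p k)
    ((muPadicSystem K p).projHom k) (fun _ _ => rfl) x y

end Twist

/-! ### Kato II Lemma 1.4.5 at `v ∣ p` in `ℤ_p`-coefficients -/

section Completion

variable {K : Type} [Field K] [NumberField K] {p : ℕ} [hp : Fact p.Prime]

attribute [local instance] neZero_pow₅

/-- ★★ **Kato II Lemma 1.4.5 / Serre XIV §1 Prop. 3 at a completion `K_v`, `v ∣ p`, in `ℤ_p`-coefficients.** Let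
`κ : Γ_K ↠ ℤ_p` be the cyclotomic `ℤ_p`-extension (`ker κ = ε_p⁻¹(μ(ℤ_p))`), `v ∣ p` (`|p|_v < 1`), `u ∈ 𝒪_vˣ` (`|u|_v = 1`),
`σ ∈ Γ_K` with `ε_p(σ) = N_{K_v/ℚ_p}(u)` in `ℚ_p`, and let `ψ : Γ_{K_v} → ℤ_p` be any continuous additive map with
`ψ(τ) = κ(res_v τ)`. Then, for the `p`-adic Kummer class `κ_∞(u) ∈ H¹(Γ_{K_v}, ℤ_p(1))` and the twist cup product,

  `inv_∞(κ_∞(u) ∪ [ψ]) = -κ(σ)` in `ℤ_p`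

— the `ℤ_p`-limit of the tree's levelwise identities `inv_{p^m}(κ_{p^m}(u) ∪ [c_m]) = -(κ σ mod p^m)`
(`invLevel_cupProduct_δ₀_eq_neg_toZModPow_of_isCyclotomic`): a `p`-adic integer is determined by its residues.
[cite: Kato1993LNM1553, Ch. II Lemma 1.4.5 and 1.4.2] [cite: SerreLocalFields1979, XIV §1 Prop. 3] -/
theorem invPadic_cupProduct_kummerPadic_eq_neg_of_isCyclotomic
    (κ : ZpExtension K p) (hκ : κ.IsCyclotomic) (v : HeightOneSpectrum (𝓞 K))
    (hpv : valuation (v.adicCompletion K) (p : v.adicCompletion K) < 1)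
    (ψ : C(absoluteGaloisGroup (v.adicCompletion K), ℤ_[p])) (hψ : ∀ σ τ, ψ (σ * τ) = ψ σ + ψ τ)
    (hψκ : ∀ τ, ψ τ = Multiplicative.toAdd (κ (absGaloisRestrict K (v.adicCompletion K) τ)))
    (u : v.adicCompletion K) (hu : u ≠ 0) (hu1 : valuation (v.adicCompletion K) u = 1)
    (σ : absoluteGaloisGroup K)
    (hσ : haveI : CharZero (v.adicCompletion K) := charZero_adicCompletion v
      letI := LocalField.padicAlgebra (v.adicCompletion K) p hpv
      (((GaloisRep.cyclotomicCharacter K p σ : ℤ_[p]ˣ) : ℤ_[p]) : ℚ_[p]) = Algebra.norm ℚ_[p] u) :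
    haveI : CharZero (v.adicCompletion K) := charZero_adicCompletion v
    invPadic (v.adicCompletion K) p ((twistPairingPadic (v.adicCompletion K) p).cupProduct
        (kummerPadic (v.adicCompletion K) p u hu) (oneCocycleClass _ (homOneCocycle (v.adicCompletion K) p ψ hψ))) =
      -Multiplicative.toAdd (κ σ) := by
  haveI : CharZero (v.adicCompletion K) := charZero_adicCompletion v
  refine PadicInt.ext_of_toZModPow.mp fun m => ?_
  rw [toZModPow_invPadic, map_neg]
  change invLevel (v.adicCompletion K) (p ^ m) (cohomologyMap ((muPadicSystem (v.adicCompletion K) p).projHom m) 2 _) = _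
  rw [cohomologyMap_projHom_cupProduct_twistPairingPadic, cohomologyMap_projHom_kummerPadic, cohomologyMap_oneCocycleClass]
  exact invLevel_cupProduct_δ₀_eq_neg_toZModPow_of_isCyclotomic κ hκ m v hpv _
    (fun τ x => by rw [pullback_scalarEndPadicMor_apply, hψκ]) u hu hu1 σ hσ

/-- Multiplicativity of `a ↦ a.val • x` on an `n`-torsion element `x`: `(a b).val • x = a.val • (b.val • x)`. [folklore] -/
private theorem val_mul_zsmul {M : Type*} [AddCommGroup M] {n : ℕ} [NeZero n] (a b : ZMod n) (x : M)
    (hx : (n : ℤ) • x = 0) : (((a * b).val : ℤ)) • x = ((a.val : ℤ)) • (((b.val : ℤ)) • x) := by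
  rw [← mul_zsmul, ← Nat.cast_mul, ZMod.val_mul, natMod_zsmul_eq _ x hx]

/-- ★★ **Kato II Lemma 1.4.5 at `v ∣ p` for every `ℤ_p`-MULTIPLE `ψ = a · (κ ∘ res_v)` of the cyclotomic character** (e.g.
`log χ_cyclo = log_p(γ_cyc) · κ_cyc`): `inv_∞(κ_∞(u) ∪ [ψ]) = -a · κ(σ)` in `ℤ_p` (levelwise `[ψ mod p^m·id] = (a mod p^m)•[κ mod p^m·id]`,
`ℤ`-bilinearity of the cup product). [cite: Kato1993LNM1553, Ch. II Lemma 1.4.5 and 1.4.2] [cite: SerreLocalFields1979, XIV §1 Prop. 3] -/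
theorem invPadic_cupProduct_kummerPadic_eq_neg_mul_of_isCyclotomic
    (κ : ZpExtension K p) (hκ : κ.IsCyclotomic) (v : HeightOneSpectrum (𝓞 K))
    (hpv : valuation (v.adicCompletion K) (p : v.adicCompletion K) < 1) (a : ℤ_[p])
    (ψ : C(absoluteGaloisGroup (v.adicCompletion K), ℤ_[p])) (hψ : ∀ σ τ, ψ (σ * τ) = ψ σ + ψ τ)
    (hψκ : ∀ τ, ψ τ = a * Multiplicative.toAdd (κ (absGaloisRestrict K (v.adicCompletion K) τ)))
    (u : v.adicCompletion K) (hu : u ≠ 0) (hu1 : valuation (v.adicCompletion K) u = 1) (σ : absoluteGaloisGroup K)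
    (hσ : haveI : CharZero (v.adicCompletion K) := charZero_adicCompletion v
      letI := LocalField.padicAlgebra (v.adicCompletion K) p hpv
      (((GaloisRep.cyclotomicCharacter K p σ : ℤ_[p]ˣ) : ℤ_[p]) : ℚ_[p]) = Algebra.norm ℚ_[p] u) :
    haveI : CharZero (v.adicCompletion K) := charZero_adicCompletion v
    invPadic (v.adicCompletion K) p ((twistPairingPadic (v.adicCompletion K) p).cupProduct
        (kummerPadic (v.adicCompletion K) p u hu) (oneCocycleClass _ (homOneCocycle (v.adicCompletion K) p ψ hψ))) =
      -(a * Multiplicative.toAdd (κ σ)) := by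
  haveI : CharZero (v.adicCompletion K) := charZero_adicCompletion v
  let ψ₀ : C(absoluteGaloisGroup (v.adicCompletion K), ℤ_[p]) :=
    ⟨fun τ => Multiplicative.toAdd (κ (absGaloisRestrict K (v.adicCompletion K) τ)),
      continuous_toAdd.comp ((map_continuous κ).comp (absGaloisRestrict K (v.adicCompletion K)).continuous)⟩
  have hψ₀ : ∀ σ τ, ψ₀ (σ * τ) = ψ₀ σ + ψ₀ τ := fun σ τ => by
    change Multiplicative.toAdd (κ _) = Multiplicative.toAdd (κ _) + Multiplicative.toAdd (κ _); rw [map_mul, map_mul, toAdd_mul]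
  refine PadicInt.ext_of_toZModPow.mp fun m => ?_
  rw [toZModPow_invPadic, map_neg, map_mul]
  change invLevel (v.adicCompletion K) (p ^ m) (cohomologyMap ((muPadicSystem (v.adicCompletion K) p).projHom m) 2 _) = _
  rw [cohomologyMap_projHom_cupProduct_twistPairingPadic, cohomologyMap_projHom_kummerPadic, cohomologyMap_oneCocycleClass]
  set c₀ := contOneCocycles.pullback (ContinuousMonoidHom.id _) (resIdHom (scalarEndPadicMor (v.adicCompletion K) p m))
    (homOneCocycle (v.adicCompletion K) p ψ₀ hψ₀)
  have hc : contOneCocycles.pullback (ContinuousMonoidHom.id _) (resIdHom (scalarEndPadicMor (v.adicCompletion K) p m))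
        (homOneCocycle (v.adicCompletion K) p ψ hψ) = (PadicInt.toZModPow m a).val • c₀ := by
    refine Subtype.ext (ContinuousMap.ext fun τ => TateDual.ext fun x => ?_)
    change (((PadicInt.toZModPow m (ψ τ)).val : ℤ)) • MuCarrier.toAdditive x =
      (PadicInt.toZModPow m a).val • ((((PadicInt.toZModPow m (ψ₀ τ)).val : ℤ)) • MuCarrier.toAdditive x)
    rw [hψκ, map_mul, ← natCast_zsmul]
    exact val_mul_zsmul _ _ _ (natCast_zsmul_muCarrier (v.adicCompletion K) x)
  have h1 : oneCocycleClass _ ((PadicInt.toZModPow m a).val • c₀) = _ • oneCocycleClass _ c₀ := map_nsmul (oneCocycleClassₗ _) _ c₀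
  have h2 := invLevel_cupProduct_δ₀_eq_neg_toZModPow_of_isCyclotomic κ hκ m v hpv c₀ (fun τ x => rfl) u hu hu1 σ hσ
  let ι : continuousCohomology 2 (mu (v.adicCompletion K) (p ^ m)).toTopRep →+ ZMod (p ^ m) := invLevel _ (p ^ m)
  change ι _ = _; rw [hc, h1, map_nsmul, map_nsmul ι]
  change (PadicInt.toZModPow m a).val • invLevel (v.adicCompletion K) (p ^ m) _ = _
  unfold kummerLevel; rw [h2, smul_neg, nsmul_eq_mul, ZMod.natCast_zmod_val]

end Completion

end Literature.NumberTheory.GaloisCohomology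

end
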